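import Summits.CriticalPhenomena.SAWScalingLimit.Theorems.SAWTwistedSelfEnergySubseqIdentificationParaObsNatural
import Literature.Probability.RandomPlanarGeometry.SAWParaObservableShortTime
import Literature.Probability.RandomPlanarGeometry.ObservableDriverContinuity
import Literature.Probability.RandomPlanarGeometry.LoewnerLateAgreement
import Mathlib.Topology.UniformSpace.CompactConvergence
import HarnessLib

/-!
# The capped parafermionic observable as a path functional: joint continuity and the far-driver
# lower bound
(crux `SubseqIdentification`, stmt-CriticalPhenomena-0783; line `parafermionic-martingale`, helpers of the
split piece S3c `stub_paraPassageAssembly` of the XL passage stub `stub_paraPassage`; stub-worker of the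
lead c6)

The inputs `hN` (joint continuity) and the `Q_k = 0` branch of the diagonal passage of the line, for
the capped observable `paraObsCap W w u = N_{u ∧ T_w}(w)`,
`N_t(w) = exp((5/8)(2 Log w + Log g_t'(w) - 2 Log (g_t(w) - W_t)))`, `T_w = (Im w)²/16` (inside the
short-time regime `9 t ≤ (Im w)²`, `shortTime_min_capTimeOf`):

* `exists_stability_le_capTimeOf` — uniform-in-time driver stability of `g_t(w)` AND `g_t'(w)` up to
  the cap: `|W - W₀| ≤ ω` on `[0, t]`, `ω ≤ ω₀(w)` ⇒ both move by `≤ M(w) ω` (the tree's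
  `ShortTime.dist_map_le` and `ShortTime.norm_exponent_sub_exponent_le` with `g' = e^J`,
  `‖e^J - e^{J₀}‖ ≤ 4 ‖J - J₀‖`; port of `exists_norm_base_sub_base_le_of_le_cdhksTime`);
* `continuous_mapPair_min_capTimeOf` — `(u, W) ↦ (g_{u∧T_w}(w), g'_{u∧T_w}(w))` is jointly continuous
  on `[0,∞) × C([0,∞), ℝ)` (continuity in time at a fixed driver, `ShortTime.continuousOn_map`,
  `ShortTime.continuousOn_deriv_map`; stability in the driver uniformly in time; tubes are
  compact-open neighbourhoods, `ContinuousMap.tendsto_iff_forall_isCompact_tendstoUniformlyOn`);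
* `continuous_paraObsCap_uncurry` — hence `(u, W) ↦ paraObsCap W w u` is jointly continuous (both
  logarithms stay on the principal sheet: `ShortTime.deriv_map_mem_slitPlane`,
  `ShortTime.map_sub_mem_slitPlane` of `SAWParaObservableShortTime`);
* `exp_le_norm_paraObs_of_abs_le` — the FAR-DRIVER LOWER BOUND: in the short-time regime,
  `|W_t| ≤ Ξ ⇒ ‖N_t(w)‖ ≥ exp((5/8)(2 log |w| - 1/2 - 2 log (2|w| + Ξ)))` (`g' = e^J`, `‖J‖ ≤ 1/2`,
  `‖g_t(w) - W_t‖ ≤ ‖g_t(w) - w‖ + |w| + |W_t| ≤ Im w/3 + |w| + |W_t|`): a SMALL observable forces a FAR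
  driver.

References: D. Chelkak, H. Duminil-Copin, C. Hongler, A. Kemppainen, S. Smirnov, C. R. Math. 352
(2014), §3 (equicontinuity in `t`, convergence of `G_t^δ` from that of `W_t^δ`); G. F. Lawler (2005),
§4.1 (`∂_t log g_t' = -2/(g_t - U_t)²`), §4.7 Prop. 4.47 (continuity in the driver); A. Kemppainen,
S. Smirnov, Ann. Probab. 45 (2017), App. A.
-/

noncomputable section

open MeasureTheory Filter Topology Set Metric
open scoped NNReal ENNReal Classical BigOperators
open Literature.Probability.LatticeModels
open Literature.Probability.RandomPlanarGeometry
open UpperHalfPlane (upperHalfPlaneSet)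

namespace Summit.CriticalPhenomena.SAWScalingLimit.Theorems.SubseqIdentification.ParaMartingale

open Summit.CriticalPhenomena.SAWScalingLimit.Theorems.SubseqIdentification.RoomEntropy
  (prefixAt capTimeOf)

/-! ## Driver stability of `g_t(w)` and `g_t'(w)`, uniformly up to the cap -/

/-- The cap in real terms. [folklore] -/
theorem coe_capTimeOf (w : ℂ) : ((capTimeOf w : ℝ≥0) : ℝ) = w.im ^ 2 / 16 :=
  Real.coe_toNNReal _ (by positivity)

/-- **Uniform-in-time driver stability of `g_t(w)` and `g_t'(w)` up to the cap.** For `w ∈ ℍ` there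
are `ω₀ > 0` and `M ≥ 0` such that for all continuous drivers `W₀, W`, all `t ≤ T_w = (Im w)²/16` and
all `ω ∈ [0, ω₀]`, `|W₀ - W| ≤ ω` on `[0, t]` implies `dist (g_t^{W}(w), g_t^{W₀}(w)) ≤ M ω` and
`‖g_t'^{W}(w) - g_t'^{W₀}(w)‖ ≤ M ω`. [cite: Lawler2005, §4.7 Prop. 4.47] -/
theorem exists_stability_le_capTimeOf {w : ℂ} (hw : 0 < w.im) :
    ∃ ω₀ > 0, ∃ M ≥ 0, ∀ (W₀ W : ℝ≥0 → ℝ), Continuous W₀ → Continuous W →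
      ∀ t ≤ capTimeOf w, ∀ ω, 0 ≤ ω → ω ≤ ω₀ → (∀ s : ℝ≥0, s ≤ t → |W₀ s - W s| ≤ ω) →
        dist (Loewner.map W t w) (Loewner.map W₀ t w) ≤ M * ω ∧
        ‖deriv (Loewner.map W t) w - deriv (Loewner.map W₀ t) w‖ ≤ M * ω := by
  -- adapted from `Loewner.exists_norm_base_sub_base_le_of_le_cdhksTime` (ObservableLimitPassage)
  set y : ℝ := w.im with hy_def
  have hy : 0 < y := hw
  set a : ℝ := 2 * y / 3 with ha
  have ha0 : 0 < a := by positivity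
  set Es : ℝ := Real.exp 2 with hEs
  have hEs0 : 0 < Es := Real.exp_pos _
  set Ls : ℝ := 4 / a ^ 3 * Es * (y ^ 2 / 16) with hLs
  have hLs0 : 0 ≤ Ls := by positivity
  set M : ℝ := Es + 4 * Ls with hM
  have hM0 : 0 ≤ M := by positivity
  set ω₀ : ℝ := min (y / 6 / (Es + 1)) (1 / (Ls + 1)) with hω₀
  have hω₀pos : 0 < ω₀ := by positivity
  refine ⟨ω₀, hω₀pos, M, hM0, fun W₀ W hW₀ hW t ht ω hω0 hωle hWW ↦ ?_⟩
  have htreal : (t : ℝ) ≤ y ^ 2 / 16 := by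
    have := NNReal.coe_le_coe.2 ht
    rwa [coe_capTimeOf] at this
  have hST : Loewner.ShortTime W₀ w t := ⟨hW₀, hw, by change 9 * (t : ℝ) ≤ y ^ 2; nlinarith⟩
  have hST' : Loewner.ShortTime W w t := ⟨hW, hw, hST.nine⟩
  set E : ℝ := Real.exp (18 / y ^ 2 * t) with hE
  have hE0 : 0 < E := Real.exp_pos _
  have hE1 : 1 ≤ E := Real.one_le_exp (by positivity)
  have hEle : E ≤ Es := by
    refine Real.exp_le_exp.2 ?_
    have h1 : 18 / y ^ 2 * (t : ℝ) ≤ 18 / y ^ 2 * (y ^ 2 / 16) := by gcongr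
    have h2 : 18 / y ^ 2 * (y ^ 2 / 16) = 9 / 8 := by field_simp; ring
    linarith
  have hω₀1 : ω₀ ≤ y / 6 / (Es + 1) := min_le_left _ _
  have hω₀2 : ω₀ ≤ 1 / (Ls + 1) := min_le_right _ _
  have hω1 : ω ≤ w.im / 6 := by
    calc ω ≤ y / 6 / (Es + 1) := hωle.trans hω₀1
      _ ≤ y / 6 := div_le_self (by positivity) (by linarith)
  have hω2 : ω * (Real.exp (18 / w.im ^ 2 * t) - 1) < w.im / 6 := by
    rw [← hy_def, ← hE]
    have h1 : ω * (E - 1) ≤ ω * Es := by nlinarith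
    have h2 : ω * (Es + 1) ≤ y / 6 := by
      have := hωle.trans hω₀1
      rwa [le_div_iff₀ (by positivity)] at this
    nlinarith
  -- the maps
  have hmap : dist (Loewner.map W t w) (Loewner.map W₀ t w) ≤ M * ω := by
    have h1 := hST.dist_map_le hW hω0 hω1 hω2 hWW le_rfl
    rw [← hy_def, ← hE] at h1
    calc dist (Loewner.map W t w) (Loewner.map W₀ t w) ≤ ω * (E - 1) := h1
      _ ≤ Es * ω := by nlinarith
      _ ≤ M * ω := by rw [hM]; nlinarith
  refine ⟨hmap, ?_⟩
  -- the derivatives: `g' = e^J`, `‖J - J₀‖ ≤ Ls ω ≤ 1`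
  obtain ⟨g, hg⟩ := hST'.exists_sol
  obtain ⟨g₀, hg₀⟩ := hST.exists_sol
  have hJ := Loewner.ShortTime.norm_exponent_sub_exponent_le hST hW hω0 hω1 hω2 hWW hg hg₀
  rw [← hy_def, ← hE] at hJ
  have hJ' : ‖(∫ s in (0 : ℝ)..t, (-2 : ℂ) / ((g s - W s.toNNReal) * (g s - W s.toNNReal))) -
      ∫ s in (0 : ℝ)..t, (-2 : ℂ) / ((g₀ s - W₀ s.toNNReal) * (g₀ s - W₀ s.toNNReal))‖ ≤ Ls * ω := by
    refine hJ.trans ?_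
    rw [← ha]
    have : 4 / a ^ 3 * (ω * E) * t = (4 / a ^ 3 * E * t) * ω := by ring
    rw [this]
    refine mul_le_mul_of_nonneg_right ?_ hω0
    rw [hLs]
    gcongr
  have hLω : Ls * ω ≤ 1 := by
    have h3 : ω ≤ 1 / (Ls + 1) := hωle.trans hω₀2
    have h4 : ω * (Ls + 1) ≤ 1 := by rwa [le_div_iff₀ (by positivity)] at h3
    nlinarith
  rw [hST'.deriv_map_eq hg, hST.deriv_map_eq hg₀]
  calc ‖Complex.exp (∫ s in (0 : ℝ)..t, (-2 : ℂ) / ((g s - W s.toNNReal) * (g s - W s.toNNReal))) -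
        Complex.exp (∫ s in (0 : ℝ)..t, (-2 : ℂ) / ((g₀ s - W₀ s.toNNReal) * (g₀ s - W₀ s.toNNReal)))‖
      ≤ 4 * ‖(∫ s in (0 : ℝ)..t, (-2 : ℂ) / ((g s - W s.toNNReal) * (g s - W s.toNNReal))) -
          ∫ s in (0 : ℝ)..t, (-2 : ℂ) / ((g₀ s - W₀ s.toNNReal) * (g₀ s - W₀ s.toNNReal))‖ :=
        Loewner.ShortTime.norm_exp_sub_exp_le (hST.norm_exponent_le hg₀) (hJ'.trans hLω)
    _ ≤ 4 * (Ls * ω) := by gcongr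
    _ ≤ M * ω := by rw [hM]; nlinarith

/-! ## Joint continuity in (time, driver) -/

/-- **`(u, W) ↦ (g_{u ∧ T_w}(w), g'_{u ∧ T_w}(w))` is jointly continuous** on `[0,∞) × C([0,∞), ℝ)`
(compact-open topology): continuity in time at a fixed driver (`ShortTime.continuousOn_map`,
`ShortTime.continuousOn_deriv_map`) and stability in the driver uniformly in time
(`exists_stability_le_capTimeOf`). [cite: CDHKSCRAS2014, §3] -/
theorem continuous_mapPair_min_capTimeOf {w : ℂ} (hw : 0 < w.im) :
    Continuous fun p : ℝ≥0 × C(ℝ≥0, ℝ) ↦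
      (Loewner.map p.2 (min p.1 (capTimeOf w)) w, deriv (Loewner.map p.2 (min p.1 (capTimeOf w))) w) := by
  -- adapted from `Loewner.continuous_base_min_cdhksTime` (ObservableLimitPassage)
  set b : (ℝ≥0 → ℝ) → ℝ≥0 → ℂ × ℂ := fun W t ↦ (Loewner.map W t w, deriv (Loewner.map W t) w)
    with hb
  change Continuous fun p : ℝ≥0 × C(ℝ≥0, ℝ) ↦ b p.2 (min p.1 (capTimeOf w))
  obtain ⟨ω₀, hω₀, M, hM, hstab⟩ := exists_stability_le_capTimeOf hw
  rw [continuous_iff_continuousAt]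
  rintro ⟨u₀, W₀⟩
  rw [ContinuousAt, Metric.tendsto_nhds]
  intro ε hε
  -- continuity in time at the fixed driver `W₀`
  have hT : Loewner.ShortTime W₀ w (capTimeOf w) := by
    have := shortTime_min_capTimeOf W₀.continuous hw (capTimeOf w)
    rwa [min_self] at this
  have htime : Continuous fun u : ℝ≥0 ↦ b W₀ (min u (capTimeOf w)) :=
    (hT.continuousOn_map.prodMk hT.continuousOn_deriv_map).comp_continuous
      (continuous_id.min continuous_const) fun _ ↦ ⟨bot_le, min_le_right _ _⟩
  have h1 : ∀ᶠ u in 𝓝 u₀,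
      dist (b W₀ (min u (capTimeOf w))) (b W₀ (min u₀ (capTimeOf w))) < ε / 2 :=
    Metric.tendsto_nhds.1 (htime.tendsto u₀) (ε / 2) (half_pos hε)
  -- closeness of the drivers on `[0, T_w]`
  set ω : ℝ := min ω₀ (ε / 2 / (M + 1)) with hω
  have hωpos : 0 < ω := by positivity
  have h2 : ∀ᶠ W in 𝓝 W₀, ∀ s ∈ Icc (0 : ℝ≥0) (capTimeOf w), dist (W₀ s) (W s) < ω := by
    have := (ContinuousMap.tendsto_iff_forall_isCompact_tendstoUniformlyOn.1
      (tendsto_id (x := 𝓝 W₀))) (Icc 0 (capTimeOf w)) isCompact_Icc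
    exact (Metric.tendstoUniformlyOn_iff.1 this) ω hωpos
  rw [nhds_prod_eq]
  refine (h1.prod_mk h2).mono ?_
  rintro ⟨u, W⟩ ⟨hu, hWn⟩
  simp only at hu hWn ⊢
  set t := min u (capTimeOf w) with ht
  have htT : t ≤ capTimeOf w := min_le_right _ _
  have hWW : ∀ s : ℝ≥0, s ≤ t → |W₀ s - W s| ≤ ω := fun s hs ↦ by
    have := hWn s ⟨bot_le, hs.trans htT⟩
    rw [Real.dist_eq] at this
    exact this.le
  obtain ⟨hm, hd⟩ := hstab W₀ W W₀.continuous W.continuous t htT ω hωpos.le (min_le_left _ _) hWW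
  have hMω : M * ω ≤ ε / 2 / (M + 1) * M := by
    rw [mul_comm]; exact mul_le_mul_of_nonneg_right (min_le_right _ _) hM
  have hMω' : M * ω < ε / 2 := by
    have h3 : ε / 2 / (M + 1) * M < ε / 2 := by
      rw [div_mul_eq_mul_div, div_lt_iff₀ (by positivity)]; nlinarith
    exact hMω.trans_lt h3
  calc dist (b W t) (b W₀ (min u₀ (capTimeOf w)))
      ≤ dist (b W t) (b W₀ t) + dist (b W₀ t) (b W₀ (min u₀ (capTimeOf w))) := dist_triangle _ _ _
    _ < ε / 2 + ε / 2 := by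
        refine add_lt_add_of_lt_of_lt ?_ hu
        refine (Prod.dist_eq (x := b W t) (y := b W₀ t)).le.trans_lt (max_lt ?_ ?_)
        · exact hm.trans_lt hMω'
        · rw [dist_eq_norm]; exact hd.trans_lt hMω'
    _ = ε := by ring

/-- **The capped parafermionic observable `(u, W) ↦ paraObsCap W w u` is jointly continuous** on
`[0,∞) × C([0,∞), ℝ)`: by `continuous_mapPair_min_capTimeOf` and the joint continuity of evaluation,
both arguments of the principal logarithm depending continuously on `(u, W)` and staying on the
principal sheet (`ShortTime.deriv_map_mem_slitPlane`, `ShortTime.map_sub_mem_slitPlane`). This is the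
hypothesis `hN` of the passage theorem `stub_passageUI`. [cite: CDHKSCRAS2014, §3] -/
theorem continuous_paraObsCap_uncurry {w : ℂ} (hw : 0 < w.im) :
    Continuous fun p : ℝ≥0 × C(ℝ≥0, ℝ) ↦ paraObsCap p.2 w p.1 := by
  have hpair := continuous_mapPair_min_capTimeOf hw
  have hm : Continuous fun p : ℝ≥0 × C(ℝ≥0, ℝ) ↦ Loewner.map p.2 (min p.1 (capTimeOf w)) w :=
    continuous_fst.comp hpair
  have hd : Continuous fun p : ℝ≥0 × C(ℝ≥0, ℝ) ↦
      deriv (Loewner.map p.2 (min p.1 (capTimeOf w))) w := continuous_snd.comp hpair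
  have hv : Continuous fun p : ℝ≥0 × C(ℝ≥0, ℝ) ↦ ((p.2 (min p.1 (capTimeOf w)) : ℝ) : ℂ) :=
    Complex.continuous_ofReal.comp (continuous_eval.comp
      (continuous_snd.prodMk (continuous_fst.min continuous_const)))
  have hST : ∀ p : ℝ≥0 × C(ℝ≥0, ℝ), Loewner.ShortTime p.2 w (min p.1 (capTimeOf w)) := fun p ↦
    shortTime_min_capTimeOf p.2.continuous hw p.1
  unfold paraObsCap paraObs
  exact (((continuous_const.add (hd.clog fun p ↦ (hST p).deriv_map_mem_slitPlane)).sub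
    (continuous_const.mul ((hm.sub hv).clog fun p ↦ (hST p).map_sub_mem_slitPlane))).const_mul
      _).cexp

/-! ## The far-driver lower bound -/

/-- **A small observable forces a far driver.** In the short-time regime `9 t ≤ (Im w)²`, if
`|W_t| ≤ Ξ` then `‖N_t(w)‖ ≥ exp((5/8)(2 log |w| - 1/2 - 2 log (2 |w| + Ξ)))`:
`|N| = exp((5/8)(2 log |w| + Re J - 2 log |g_t(w) - W_t|))` with `g_t' = e^J`, `Re J ≥ -‖J‖ ≥ -1/2`,
and `|g_t(w) - W_t| ≤ |g_t(w) - w| + |w| + |W_t| ≤ (Im w)/3 + |w| + Ξ ≤ 2|w| + Ξ`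
(`ShortTime.norm_map_sub_self_le`). [cite: LawlerSchrammWerner2004SAW, §4.1] -/
theorem exp_le_norm_paraObs_of_abs_le {W : ℝ≥0 → ℝ} {w : ℂ} {t : ℝ≥0} (h : Loewner.ShortTime W w t)
    {Ξ : ℝ} (hΞ : |W t| ≤ Ξ) :
    Real.exp (5 / 8 * (2 * Real.log ‖w‖ - 1 / 2 - 2 * Real.log (2 * ‖w‖ + Ξ))) ≤
      ‖paraObs W w t‖ := by
  have hw : 0 < w.im := h.im_pos
  have hw0 : 0 < ‖w‖ := norm_pos_iff.2 fun h0 ↦ by rw [h0, Complex.zero_im] at hw; exact lt_irrefl _ hw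
  have hΞ0 : 0 ≤ Ξ := (abs_nonneg _).trans hΞ
  obtain ⟨g, hg⟩ := h.exists_sol
  set J := ∫ s in (0 : ℝ)..t, (-2 : ℂ) / ((g s - W s.toNNReal) * (g s - W s.toNNReal)) with hJdef
  have hJ : ‖J‖ ≤ 1 / 2 := h.norm_exponent_le hg
  have hD : Real.log ‖deriv (Loewner.map W t) w‖ = J.re := by
    rw [h.deriv_map_eq hg, Complex.norm_exp, Real.log_exp]
  have hJre : -(1 / 2) ≤ J.re := by
    have := (abs_le.1 (Complex.abs_re_le_norm J)).1
    linarith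
  -- `|g_t(w) - W_t| ≤ 2|w| + Ξ`
  have hG0 : 0 < ‖Loewner.map W t w - W t‖ := by linarith [h.norm_map_sub_lower]
  have hGle : ‖Loewner.map W t w - W t‖ ≤ 2 * ‖w‖ + Ξ := by
    have h1 : ‖Loewner.map W t w - w‖ ≤ 3 * t / w.im := h.norm_map_sub_self_le
    have h2 : 3 * (t : ℝ) / w.im ≤ w.im / 3 := by
      rw [div_le_iff₀ hw]; nlinarith [h.nine]
    have h3 : w.im ≤ ‖w‖ := (le_abs_self _).trans (Complex.abs_im_le_norm w)
    have h4 : ‖((W t : ℝ) : ℂ)‖ ≤ Ξ := by rw [Complex.norm_real, Real.norm_eq_abs]; exact hΞ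
    calc ‖Loewner.map W t w - W t‖ = ‖(Loewner.map W t w - w) + w - (W t : ℂ)‖ := by ring_nf
      _ ≤ ‖Loewner.map W t w - w‖ + ‖w‖ + ‖((W t : ℝ) : ℂ)‖ := by
          linarith [norm_sub_le (Loewner.map W t w - w + w) ((W t : ℝ) : ℂ),
            norm_add_le (Loewner.map W t w - w) w]
      _ ≤ w.im / 3 + ‖w‖ + Ξ := by linarith
      _ ≤ 2 * ‖w‖ + Ξ := by linarith
  have hre : ((5 / 8 : ℂ) * (2 * Complex.log w + Complex.log (deriv (Loewner.map W t) w) -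
      2 * Complex.log (Loewner.map W t w - W t))).re =
      5 / 8 * (2 * Real.log ‖w‖ + Real.log ‖deriv (Loewner.map W t) w‖ -
        2 * Real.log ‖Loewner.map W t w - W t‖) := by
    have h58 : (5 / 8 : ℂ) = ((5 / 8 : ℝ) : ℂ) := by push_cast; ring
    rw [h58, Complex.re_ofReal_mul]
    simp [Complex.log_re]
  unfold paraObs
  rw [Complex.norm_exp, hre, hD]
  refine Real.exp_le_exp.2 (mul_le_mul_of_nonneg_left ?_ (by norm_num))
  have hlog : Real.log ‖Loewner.map W t w - W t‖ ≤ Real.log (2 * ‖w‖ + Ξ) := Real.log_le_log hG0 hGle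
  linarith

end Summit.CriticalPhenomena.SAWScalingLimit.Theorems.SubseqIdentification.ParaMartingale

end
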